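/-
Origin: expansion seat `planner-pub-hodgecm-pv03-g6-0`, handover #1 2026-08-18T10:29:03Z (`HOME/pub-hodgecm-pv03-g6/lean/Pv03g6/HodgeRieszCM.lean`, md5 c272cd1d, 501 lines);
landed by the gen-7 packager in gate run 28 as `HodgeCM/Model/ToyG2/HodgeRieszCM.lean` (verbatim).
-/
/-
Copyright (c) 2026. All rights reserved.
Released under Apache 2.0 license as described in the file LICENSE.
-/
import Mathlib
import Summits.HodgeConjecture.HodgeCM.Model.ToyG2.HodgeRieszFree
import Summits.HodgeConjecture.HodgeCM.Model.ToyG2.EquivRepr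
import Summits.HodgeConjecture.HodgeCM.Model.Toy.StarHodge

/-!
# ToyG2.HodgeRieszCM — `HodgeRiesz` for every good object carrying conjugation data (G3′, CM case)

Seat `planner-pub-hodgecm-pv03-g6-0` (DAG-node prover #03, gen 6), node M26 / G3′ of the toy-g2 programme
(`GysinPlan.lean`: `HodgeRiesz`; `RadicalProd.lean`: `hodgeRiesz_of_prodStep`).

For a GOOD object `X : Obj₂` whose gen-1 object `X.toObj` carries conjugation data `C : X.toObj.ConjData`
(`StarObj.lean`: on every atom field a ring endomorphism that is complex conjugation under every complex
embedding — every CM atom has one) we prove `HodgeRiesz X`:  every rational functional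
`lam : ⋀⁴ H¹(X) → ℚ` of Hodge type `(2,2)` killing the left radical of the trace pairing
`⋀⁴ × ⋀^{2d-4} → ℚ` is `y ↦ tr_X (y ∧ c)` for a rational HODGE class `c` of type `(d-2, d-2)` — with NO
hypothesis on the shape of `X` (blocks with degenerate pairings allowed).

## Proof (the engine is `EquivRepr.lean`, toy-g2 #6)
* over `ℚ`: `S := β_{C.form} = ⋀^b (twisted trace form)` (`StarDual.β`) is symmetric and ANISOTROPIC on
  `⋀^b H¹(X)` (`β_form_anisotropic`), so `exists_isCanonRepr` gives the canonical (`S`-orthogonal to the right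
  radical) representative `c` of `lam` (`IsCanonRepr`);
* over `ℂ`: the complexified data `(tr_ℂ (· ∧ ·), β_{C.formC}, lam_ℂ)` still has `c_ℂ = Θ(1 ⊗ c)` as a
  canonical representative (checked on complexified rational classes: `ext_theta`, `wedge_theta_one_tmul`,
  `ConjData.β_formC_thetaLin`);
  it is invariant under the pair `(2⁻² wt₂, 2^{-(d-2)} wt₂)` of rescaled weight operators (trace of type
  `(d,d)`: `trType_of_good`; `lam` of type `(2,2)`; `β_{C.formC}(wt_z w, wt_z w') = z^b β_{C.formC}(w,w')`:
  `β_formC_wt_wt`), and canonical representatives over `ℂ` are UNIQUE because `β_{C.formC}(x, conj x) = Σ_S |x_S|²`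
  in the eigen-wedge basis (`β_formC_conjK_self`; `conjK` = complex conjugation on `⋀^b_ℂ (ℂ ⊗ H¹)`, which
  preserves the right radical of the rational pairing): `IsCanonRepr.fixed`.  Hence `wt₂ c_ℂ = 2^{d-2} c_ℂ`,
  i.e. `c` is a Hodge class (`Obj.mem_hodgeClasses_of_wt_two`).

Main result: **`hodgeRiesz_of_conjData (X : Obj₂) (hX : X.Good) (C : X.toObj.ConjData) : HodgeRiesz X`**.

SCOPE REMARK.  `Atom.cm` only asks that the declared type `Φ` contain exactly one of each pair of conjugate
embeddings; it does NOT make `F` a CM field (a non-CM totally imaginary field with such a `Φ` is an `Atom`), and an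
atom carries `ConjData` iff every complex embedding of `F` intertwines one fixed endomorphism with complex
conjugation, i.e. iff `F` is a CM field (`Atom.cm` excludes totally real `F`).  Good objects built from CM atoms (all
`cmObj₂ K Φ`, all period leaves `pLeafOf L ι₁ d t`, their products and blocks over them) carry `ConjData`
(constructors in `G4WitnessCM.lean`); for the other good objects the conjugation-compatible anisotropic form used
below is not available (their Hodge structures need not be polarisable), and `HodgeRiesz` is neither proved nor
refuted for them here.
-/

namespace HodgeCM.ToyG2

open HodgeCM.Toy HodgeCM.Toy.CMPresentation
open Literature.AlgebraicGeometry.Motives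
open scoped TensorProduct ComplexConjugate
open exteriorPower Obj₂ Module

noncomputable section

/-! ### §1 Generic exterior-power lemmas -/
section Generic

variable {R : Type*} [Field R] {V : Type*} [AddCommGroup V] [Module R V]

/-- `⋀^k (z • f) = z ^ k • ⋀^k f` -/
lemma map_smul_pow (k : ℕ) (z : R) (f : V →ₗ[R] V) : map k (z • f) = z ^ k • map k f := by
  apply linearMap_ext
  refine AlternatingMap.ext fun u => ?_
  simp only [LinearMap.compAlternatingMap_apply, map_apply_ιMulti, LinearMap.smul_apply, Function.comp_def]
  have h : (fun i => z • f (u i)) = fun i => (fun _ => z) i • (fun i => f (u i)) i := rfl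
  rw [h, AlternatingMap.map_smul_univ, Finset.prod_const, Finset.card_univ, Fintype.card_fin]

/-- the Gram-determinant form of a symmetric form is symmetric -/
lemma β_symm {b : LinearMap.BilinForm R V} (hb : ∀ u w, b u w = b w u) {k : ℕ} (x y : ⋀[R]^k V) :
    Star.β b x y = Star.β b y x := by
  have key : Star.β (k := k) b = (Star.β (k := k) b).flip := by
    apply linearMap_ext
    refine AlternatingMap.ext fun u => ?_
    apply linearMap_ext
    refine AlternatingMap.ext fun w => ?_
    simp only [LinearMap.compAlternatingMap_apply, LinearMap.flip_apply, Star.β_ιMulti]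
    rw [← Matrix.det_transpose]
    congr 1
    ext i j
    simp only [Matrix.transpose_apply, Matrix.of_apply, hb]
  conv_lhs => rw [key]
  rfl

end Generic

/-! ### §2 The twisted trace form: symmetry, and the value `formC (e_s, e_s̄) = 1` -/
section Form

variable {A : Obj} (C : A.ConjData)

/-- (Ported verbatim from the HodgeCMPerL package; no docstring in the source.) -/
lemma form_symm (x y : A.L) : C.form x y = C.form y x := by
  rw [C.form_apply, C.form_apply]
  refine Finset.sum_congr rfl fun i _ => ?_
  rw [← trace_conj_eq (C.c i) (C.emb_c i) (y i * C.c i (x i)), RingHom.map_mul, C.c_c, mul_comm]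

/-- (Ported verbatim from the HodgeCMPerL package; no docstring in the source.) -/
lemma formC_symm (x y : A.LC) : C.formC x y = C.formC y x := by
  induction x using TensorProduct.induction_on with
  | zero => simp
  | tmul z m =>
    induction y using TensorProduct.induction_on with
    | zero => simp
    | tmul z' m' => rw [C.formC_tmul, C.formC_tmul, form_symm, mul_comm]
    | add y₁ y₂ h₁ h₂ => simp only [map_add, LinearMap.add_apply, h₁, h₂]
  | add x₁ x₂ h₁ h₂ => simp only [map_add, LinearMap.add_apply, h₁, h₂]

/-- (Ported verbatim from the HodgeCMPerL package; no docstring in the source.) -/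
lemma form_single_single (i : A.s.toType) (b b' : (A.atom i).F) :
    C.form (Pi.single i b) (Pi.single i b') = Algebra.trace ℚ _ (b * C.c i b') := by
  rw [C.form_apply, Finset.sum_eq_single i]
  · rw [Pi.single_eq_same, Pi.single_eq_same]
  · intro j _ hj
    rw [Pi.single_eq_of_ne hj, zero_mul, map_zero]
  · intro h
    exact absurd (Finset.mem_univ i) h

/-- bilinear expansion of `formC` on rational sums -/
lemma formC_sum_smul_tmul {ι κ : Type*} [Fintype ι] [Fintype κ] (a : ι → ℂ) (u : ι → A.L) (a' : κ → ℂ)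
    (u' : κ → A.L) :
    C.formC (∑ m, a m • ((1 : ℂ) ⊗ₜ[ℚ] u m)) (∑ m', a' m' • ((1 : ℂ) ⊗ₜ[ℚ] u' m'))
      = ∑ m, ∑ m', a m * a' m' * (C.form (u m) (u' m') : ℂ) := by
  simp only [map_sum, map_smul, LinearMap.sum_apply, LinearMap.smul_apply, C.formC_tmul, mul_one,
    Rat.smul_one_eq_cast, smul_eq_mul, Finset.mul_sum]
  rw [Finset.sum_comm]
  refine Finset.sum_congr rfl fun m _ => ?_
  refine Finset.sum_congr rfl fun m' _ => ?_
  ring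

/-- **`formC (e_s, e_s̄) = 1`** -/
theorem formC_eB_bar (s : A.Idx) : C.formC (A.eB s) (A.eB (A.bar s)) = 1 := by
  classical
  obtain ⟨i, τ⟩ := s
  show C.formC (A.eB ⟨i, τ⟩) (A.eB ⟨i, NumberField.ComplexEmbedding.conjugate τ⟩) = 1
  rw [A.eB_expand ⟨i, τ⟩, A.eB_expand ⟨i, NumberField.ComplexEmbedding.conjugate τ⟩, formC_sum_smul_tmul]
  unfold Obj.coef Obj.vec
  dsimp only
  -- `Tr(b_m c(b_m')) = Σ_ρ ρ(b_m) conj ρ(b_m')`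
  have htr : ∀ m m' : Fin (Module.finrank ℚ (A.atom i).F),
      ((C.form (Pi.single i (bF (A.atom i).F m)) (Pi.single i (bF (A.atom i).F m')) : ℚ) : ℂ)
        = ∑ ρ : (A.atom i).F →+* ℂ, ρ (bF (A.atom i).F m) * conj (ρ (bF (A.atom i).F m')) := by
    intro m m'
    rw [form_single_single, trace_eq_sum_ringHom]
    refine Finset.sum_congr rfl fun ρ _ => ?_
    rw [map_mul, C.emb_c]
  simp_rw [htr]
  calc ∑ m, ∑ m', τ (dF (A.atom i).F m) * NumberField.ComplexEmbedding.conjugate τ (dF (A.atom i).F m')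
          * ∑ ρ : (A.atom i).F →+* ℂ, ρ (bF (A.atom i).F m) * conj (ρ (bF (A.atom i).F m'))
      = ∑ m, ∑ m', ∑ ρ : (A.atom i).F →+* ℂ, (τ (dF (A.atom i).F m) * ρ (bF (A.atom i).F m))
          * (NumberField.ComplexEmbedding.conjugate τ (dF (A.atom i).F m') * conj (ρ (bF (A.atom i).F m'))) := by
        refine Finset.sum_congr rfl fun m _ => ?_
        refine Finset.sum_congr rfl fun m' _ => ?_
        rw [Finset.mul_sum]
        refine Finset.sum_congr rfl fun ρ _ => ?_
        ring
    _ = ∑ m, ∑ ρ : (A.atom i).F →+* ℂ, ∑ m', (τ (dF (A.atom i).F m) * ρ (bF (A.atom i).F m))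
          * (NumberField.ComplexEmbedding.conjugate τ (dF (A.atom i).F m') * conj (ρ (bF (A.atom i).F m'))) := by
        refine Finset.sum_congr rfl fun m _ => ?_
        exact Finset.sum_comm
    _ = ∑ ρ : (A.atom i).F →+* ℂ, ∑ m, ∑ m', (τ (dF (A.atom i).F m) * ρ (bF (A.atom i).F m))
          * (NumberField.ComplexEmbedding.conjugate τ (dF (A.atom i).F m') * conj (ρ (bF (A.atom i).F m'))) :=
        Finset.sum_comm
    _ = ∑ ρ : (A.atom i).F →+* ℂ, (∑ m, τ (dF (A.atom i).F m) * ρ (bF (A.atom i).F m))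
          * ∑ m', NumberField.ComplexEmbedding.conjugate τ (dF (A.atom i).F m') * conj (ρ (bF (A.atom i).F m')) := by
        refine Finset.sum_congr rfl fun ρ _ => ?_
        rw [Finset.sum_mul_sum]
    _ = ∑ ρ : (A.atom i).F →+* ℂ, if ρ = τ then 1 else 0 := by
        refine Finset.sum_congr rfl fun ρ _ => ?_
        rw [sum_emb_dF_mul_emb_bF, sum_emb_dF_mul_conj_emb_bF]
        by_cases h : ρ = τ
        · subst h
          simp
        · have h' : NumberField.ComplexEmbedding.conjugate ρ ≠ NumberField.ComplexEmbedding.conjugate τ :=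
            fun e => h (by simpa using congrArg NumberField.ComplexEmbedding.conjugate e)
          simp [h, h']
    _ = 1 := by simp

end Form

/-! ### §3 Complex conjugation on `⋀^k_ℂ (ℂ ⊗ H¹)` -/
section Conj

variable (A : Obj) (k : ℕ)

/-- (Ported verbatim from the HodgeCMPerL package; no docstring in the source.) -/
lemma tmul_eq_smul_one_tmul {M : Type*} [AddCommGroup M] [Module ℚ M] (z : ℂ) (x : M) :
    z ⊗ₜ[ℚ] x = z • ((1 : ℂ) ⊗ₜ[ℚ] x) := by
  rw [TensorProduct.smul_tmul', smul_eq_mul, mul_one]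

/-- (Ported verbatim from the HodgeCMPerL package; no docstring in the source.) -/
lemma theta_tmul' (z : ℂ) (x : ⋀[ℚ]^k A.L) : A.Θ k (z ⊗ₜ[ℚ] x) = z • A.Θ k ((1 : ℂ) ⊗ₜ[ℚ] x) := by
  rw [tmul_eq_smul_one_tmul z x, LinearEquiv.map_smul]

/-- **complex conjugation** on `⋀^k_ℂ (ℂ ⊗ L)`, transported from `conj ⊗ 1` on `ℂ ⊗ ⋀^k L` along `Θ`;
a `conj`-semilinear map -/
def conjK : ⋀[ℂ]^k A.LC →ₗ⋆[ℂ] ⋀[ℂ]^k A.LC where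
  toFun x := A.Θ k (HodgeStructure.conj ((A.Θ k).symm x))
  map_add' x y := by simp only [map_add]
  map_smul' z x := by
    simp only [LinearEquiv.map_smul, HodgeStructure.conj_smul]

/-- (Ported verbatim from the HodgeCMPerL package; no docstring in the source.) -/
lemma conjK_apply (x : ⋀[ℂ]^k A.LC) : conjK A k x = A.Θ k (HodgeStructure.conj ((A.Θ k).symm x)) := rfl

/-- (Ported verbatim from the HodgeCMPerL package; no docstring in the source.) -/
@[simp] lemma conjK_conjK (x : ⋀[ℂ]^k A.LC) : conjK A k (conjK A k x) = x := by
  simp only [conjK_apply, LinearEquiv.symm_apply_apply, HodgeStructure.conj_conj, LinearEquiv.apply_symm_apply]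

/-- conjugation of eigen-monomials: `conj e_g = e_ḡ` (gen 1, `conj_theta_symm_mono`) -/
lemma conjK_mono (g : Fin k → A.Idx) : conjK A k (A.mono k g) = A.mono k (A.bar ∘ g) := by
  rw [conjK_apply, A.conj_theta_symm_mono, LinearEquiv.apply_symm_apply]

/-- (Ported verbatim from the HodgeCMPerL package; no docstring in the source.) -/
lemma conjK_basis (S : Set.powersetCard A.Idx k) :
    conjK A k (A.eB.exteriorPower k S) = A.mono k (A.bar ∘ enum A S) := by
  rw [basis_eq_mono, conjK_mono]

/-- complexified rational classes are real -/
@[simp] lemma conjK_theta_one_tmul (x : ⋀[ℚ]^k A.L) :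
    conjK A k (A.Θ k ((1 : ℂ) ⊗ₜ[ℚ] x)) = A.Θ k ((1 : ℂ) ⊗ₜ[ℚ] x) := by
  rw [conjK_apply, LinearEquiv.symm_apply_apply, HodgeStructure.conj_tmul, map_one]

/-- `Θ` is multiplicative on pure tensors -/
lemma wedge_theta_tmul (i j : ℕ) (z z' : ℂ) (x : ⋀[ℚ]^i A.L) (y : ⋀[ℚ]^j A.L) :
    wedge ℂ A.LC i j (A.Θ i (z ⊗ₜ[ℚ] x)) (A.Θ j (z' ⊗ₜ[ℚ] y))
      = A.Θ (i + j) ((z * z') ⊗ₜ[ℚ] wedge ℚ A.L i j x y) := by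
  rw [theta_tmul' A i z, theta_tmul' A j z', LinearMap.map_smul₂, map_smul, wedge_theta_one_tmul, smul_smul,
    theta_tmul' A (i + j) (z * z')]

set_option maxHeartbeats 2000000 in
/-- conjugation is multiplicative (on `Θ`-images of pure tensors in the first slot) -/
theorem conj_theta_wedge_tmul (i j : ℕ) (z : ℂ) (x : ⋀[ℚ]^i A.L) (b : ℂ ⊗[ℚ] ⋀[ℚ]^j A.L) :
    A.Θ (i + j) (HodgeStructure.conj ((A.Θ (i + j)).symm
        (wedge ℂ A.LC i j (A.Θ i (z ⊗ₜ[ℚ] x)) (A.Θ j b))))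
      = wedge ℂ A.LC i j (A.Θ i (conj z ⊗ₜ[ℚ] x)) (A.Θ j (HodgeStructure.conj b)) := by
  induction b using TensorProduct.induction_on with
  | zero => simp only [map_zero]
  | add b₁ b₂ h₁ h₂ => simp only [map_add, h₁, h₂]
  | tmul z' y =>
    rw [wedge_theta_tmul, LinearEquiv.symm_apply_apply, HodgeStructure.conj_tmul, map_mul,
      HodgeStructure.conj_tmul, wedge_theta_tmul]

set_option maxHeartbeats 2000000 in
/-- conjugation is multiplicative (on `Θ`-images of tensors) -/
theorem conj_theta_wedge (i j : ℕ) (a : ℂ ⊗[ℚ] ⋀[ℚ]^i A.L) (b : ℂ ⊗[ℚ] ⋀[ℚ]^j A.L) :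
    A.Θ (i + j) (HodgeStructure.conj ((A.Θ (i + j)).symm (wedge ℂ A.LC i j (A.Θ i a) (A.Θ j b))))
      = wedge ℂ A.LC i j (A.Θ i (HodgeStructure.conj a)) (A.Θ j (HodgeStructure.conj b)) := by
  induction a using TensorProduct.induction_on with
  | zero => simp only [map_zero, LinearMap.zero_apply]
  | add a₁ a₂ h₁ h₂ => simp only [map_add, LinearMap.add_apply, h₁, h₂]
  | tmul z x => rw [conj_theta_wedge_tmul, HodgeStructure.conj_tmul]

/-- conjugation is multiplicative -/
theorem conjK_wedge (i j : ℕ) (v : ⋀[ℂ]^i A.LC) (w : ⋀[ℂ]^j A.LC) :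
    conjK A (i + j) (wedge ℂ A.LC i j v w) = wedge ℂ A.LC i j (conjK A i v) (conjK A j w) := by
  obtain ⟨a, rfl⟩ := (A.Θ i).surjective v
  obtain ⟨b, rfl⟩ := (A.Θ j).surjective w
  simp only [conjK_apply, LinearEquiv.symm_apply_apply]
  exact conj_theta_wedge A i j a b

/-- rational functionals are real: `φ_ℂ (conj x) = conj (φ_ℂ x)` -/
theorem baseC_conjK (φ : (⋀[ℚ]^k A.L) →ₗ[ℚ] ℚ) (x : ⋀[ℂ]^k A.LC) :
    baseC A φ (conjK A k x) = conj (baseC A φ x) := by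
  obtain ⟨t, rfl⟩ := (A.Θ k).surjective x
  rw [conjK_apply, LinearEquiv.symm_apply_apply]
  induction t using TensorProduct.induction_on with
  | zero => simp
  | add t₁ t₂ h₁ h₂ => simp only [map_add, h₁, h₂]
  | tmul z y =>
    rw [HodgeStructure.conj_tmul, theta_tmul', theta_tmul' A k z, map_smul, map_smul, baseC_theta_one_tmul,
      smul_eq_mul, smul_eq_mul, map_mul, map_ratCast]

end Conj

/-! ### §4 Positivity: `β_{formC}(x, conj x) = Σ_S |x_S|²` -/
section Positivity

variable {A : Obj} (C : A.ConjData) (k : ℕ)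

/-- the Gram form on (basis vector, conjugate basis vector) is the Kronecker delta -/
theorem β_formC_basis_conjK_basis (S T : Set.powersetCard A.Idx k) :
    Star.β C.formC (A.eB.exteriorPower k S) (conjK A k (A.eB.exteriorPower k T)) = if S = T then 1 else 0 := by
  classical
  rw [conjK_basis, basis_eq_mono, Obj.mono_def, Obj.mono_def, Star.β_ιMulti]
  by_cases hST : S = T
  · subst hST
    rw [if_pos rfl]
    have hM : (Matrix.of fun a b => C.formC ((A.eB ∘ enum A S) b) ((A.eB ∘ (A.bar ∘ enum A S)) a))
        = (1 : Matrix (Fin k) (Fin k) ℂ) := by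
      ext a b
      simp only [Matrix.of_apply, Function.comp_apply]
      by_cases hab : a = b
      · subst hab
        rw [Matrix.one_apply_eq, formC_eB_bar]
      · rw [Matrix.one_apply_ne hab]
        refine C.formC_eB_eq_zero fun h => hab ?_
        exact (enum_injective A S) (A.bar_bar (enum A S a) ▸ A.bar_bar (enum A S b) ▸ congrArg A.bar h)
    rw [hM, Matrix.det_one]
  · rw [if_neg hST]
    -- a basis index of `S` outside `T` gives a zero column
    have hnot : ¬ S.val ⊆ T.val := fun hsub =>
      hST (Subtype.ext (Finset.eq_of_subset_of_card_le hsub (by rw [S.prop, T.prop])))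
    obtain ⟨s, hsS, hsT⟩ := Finset.not_subset.mp hnot
    obtain ⟨b, hb⟩ : s ∈ Set.range (enum A S) :=
      (Set.powersetCard.mem_range_ofFinEmbEquiv_symm_iff_mem S s).mpr hsS
    refine Matrix.det_eq_zero_of_column_eq_zero b fun a => ?_
    simp only [Matrix.of_apply, Function.comp_apply]
    refine C.formC_eB_eq_zero fun h => hsT ?_
    have h' : enum A T a = s := by rw [← hb, ← A.bar_bar (enum A T a), h, A.bar_bar]
    rw [← h']
    exact (Set.powersetCard.mem_range_ofFinEmbEquiv_symm_iff_mem T _).mp ⟨a, rfl⟩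

/-- **`β_{formC}(x, conj x) = Σ_S x_S · conj x_S`** in the eigen-wedge basis -/
theorem β_formC_conjK_self (x : ⋀[ℂ]^k A.LC) :
    Star.β C.formC x (conjK A k x)
      = ∑ S, (A.eB.exteriorPower k).repr x S * conj ((A.eB.exteriorPower k).repr x S) := by
  classical
  have hx : x = ∑ S, (A.eB.exteriorPower k).repr x S • A.eB.exteriorPower k S :=
    ((A.eB.exteriorPower k).sum_repr x).symm
  conv_lhs => rw [hx]
  simp only [map_sum, map_smulₛₗ, LinearMap.sum_apply, LinearMap.smul_apply, smul_eq_mul,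
    RingHom.id_apply, β_formC_basis_conjK_basis, mul_ite, mul_one, mul_zero, Finset.sum_ite_eq',
    Finset.mem_univ, if_true]
  exact Finset.sum_congr rfl fun S _ => mul_comm _ _

/-- **anisotropy over `ℂ` (twisted by conjugation)** -/
theorem eq_zero_of_β_formC_conjK (x : ⋀[ℂ]^k A.LC) (h : Star.β C.formC x (conjK A k x) = 0) : x = 0 := by
  classical
  rw [β_formC_conjK_self] at h
  have h1 : ∀ S, (A.eB.exteriorPower k).repr x S * conj ((A.eB.exteriorPower k).repr x S)
      = ((Complex.normSq ((A.eB.exteriorPower k).repr x S) : ℝ) : ℂ) := fun S => Complex.mul_conj _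
  simp only [h1, ← Complex.ofReal_sum, Complex.ofReal_eq_zero] at h
  have h2 := (Finset.sum_eq_zero_iff_of_nonneg fun S _ =>
    Complex.normSq_nonneg ((A.eB.exteriorPower k).repr x S)).mp h
  refine (A.eB.exteriorPower k).repr.injective (Finsupp.ext fun S => ?_)
  rw [map_zero, Finsupp.zero_apply]
  exact Complex.normSq_eq_zero.mp (h2 S (Finset.mem_univ S))

/-- **anisotropy over `ℚ`**: `β_{form}(w, w) = 0 → w = 0` -/
theorem β_form_anisotropic (w : ⋀[ℚ]^k A.L) (h : Star.β C.form w w = 0) : w = 0 := by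
  have h1 : Star.β C.formC (A.Θ k ((1 : ℂ) ⊗ₜ[ℚ] w)) (conjK A k (A.Θ k ((1 : ℂ) ⊗ₜ[ℚ] w))) = 0 := by
    rw [conjK_theta_one_tmul, Obj.theta_one_tmul, C.β_formC_thetaLin, h, map_zero]
  have h2 := eq_zero_of_β_formC_conjK C k _ h1
  rw [← map_zero (A.Θ k), (A.Θ k).injective.eq_iff] at h2
  exact HodgeCM.Toy.ofRat_injective (h2.trans (TensorProduct.tmul_zero _ (1 : ℂ)).symm)

end Positivity

/-! ### §5 The Gram form and the weight operators -/
section Weight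

variable {A : Obj} (C : A.ConjData)

/-- `formC (wt_z u, w) = formC (u, z · wt_{z⁻¹} w)`: the adjoint of the weight operator -/
lemma formC_wtL_adj (z : ℂ) (hz : z ≠ 0) (u w : A.LC) :
    C.formC (A.wtL z u) w = C.formC u ((z • A.wtL z⁻¹) w) := by
  suffices h : C.formC.compl₁₂ (A.wtL z) LinearMap.id = C.formC.compl₁₂ LinearMap.id (z • A.wtL z⁻¹) by
    simpa using LinearMap.congr_fun₂ h u w
  refine LinearMap.ext_basis A.eB A.eB fun s t => ?_
  simp only [LinearMap.compl₁₂_apply, LinearMap.id_apply, LinearMap.smul_apply, Obj.wtL_eB, map_smul,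
    LinearMap.smul_apply, smul_eq_mul]
  by_cases hst : t = A.bar s
  · subst hst
    by_cases hs : A.hol s
    · have hns : ¬ A.hol (A.bar s) := fun h => (A.hol_bar_iff s).mp h hs
      simp only [if_pos hs, if_neg hns, one_mul]
    · have hbs : A.hol (A.bar s) := (A.hol_bar_iff s).mpr hs
      simp only [if_neg hs, if_pos hbs, one_mul, ← mul_assoc, mul_inv_cancel₀ hz]
  · rw [C.formC_eB_eq_zero hst, mul_zero, mul_zero, mul_zero]

/-- **`β_{formC}(wt_z w, wt_z w') = z^k · β_{formC}(w, w')`** -/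
theorem β_formC_wt_wt (z : ℂ) (hz : z ≠ 0) (k : ℕ) (w w' : ⋀[ℂ]^k A.LC) :
    Star.β C.formC (A.wt z k w) (A.wt z k w') = z ^ k * Star.β C.formC w w' := by
  have h := Star.β_map_map (b := C.formC) (k := k) (fun u w => formC_wtL_adj C z hz u w) w (A.wt z k w')
  rw [map_smul_pow, LinearMap.smul_apply, map_smul, smul_eq_mul] at h
  change Star.β C.formC (A.wt z k w) (A.wt z k w') = z ^ k * Star.β C.formC w (A.wt z⁻¹ k (A.wt z k w')) at h
  rw [h, show A.wt z⁻¹ k (A.wt z k w') = w' by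
    rw [← LinearMap.comp_apply, Obj.wt_mul, inv_mul_cancel₀ hz, Obj.wt_one, LinearMap.id_apply]]

end Weight

/-! ### §6 Complexification of the representation data -/
section Complexify

variable (A : Obj)


-- port_pkg: scope closed for this part
end Complexify
end
end HodgeCM.ToyG2
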